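import Summits.QuantumFields.YangMills.Theorems.BalabanUVNodesN15NeumannCubeGradient
import Summits.QuantumFields.YangMills.Theorems.BalabanUVNodesN15BackwardShift
import HarnessLib

/-!
# Route «BalabanUVNodes» (K3⁷), node N15 = NE2, -a lane, PROGRAMME N file N-IIa: KING's PAIRING OF TWO LATTICE SPACINGS AND THE IMAGES — the reflections of the Neumann cube
# commute with the prolongation `P = pull prV` EXACTLY on points, and on bonds up to a FACE MASK times ONE OWN-DIRECTION COARSE DIFFERENCE; `𝔇(Sym′, Sym)` in closed form

Cell `pub-ymgap`, seat `pub-ymgap-dag-n15-a` (KNIT-BY-NAME, g19; D-0062; chair R424 venue; `bears_on: R4∕N15`); `--kind proof --supports stmt-QuantumFields-20544 --as helper`.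
Sequel of N-IIIa∕b∕c (`…N15NeumannCubePropagator`, `…Majorant`, `…Gradient`).  CONSUMER: dag-n15-c FILE 45 `hasMaj_idef_glued_of_cubes` (hypothesis `hDG`: the two-grid defect
`idef (pull π) (pull π) (G′_i) (G_i)` of the cube propagators) — files N-IIb∕c below assemble that letter for the Neumann cubes at `U ≡ 1`; this file is its lattice geometry.

WHAT.  §12 `faceMask R T` (fine bonds whose own direction is reflected and whose start point is not on the upper face of its coarse cell), `ownDiff` (`(DA)(x, μ) = A(x + e_μ, μ) − A(x, μ)`,
one lattice step, no `η⁻¹`), `ownDiff_apply`, `fsum_comp`∕`comp_fsum`.  §13 two residue-floor lemmas (`⌊(RB − 1 − X)∕R⌋ = B − 1 − ⌊X∕R⌋`, `⌊(X − Rt)∕R⌋ = ⌊X∕R⌋ − t`, read in `ℤ∕B`),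
`up_apply_natCast`, ★ `kingPr_imgPt` (`pr(img′_T x′) = img_T(pr x′)`: the mirrors `x′_ν = n′c_ν − ½` ARE the mirrors `x_ν = nc_ν − ½` and `⌊·∕L^r⌋` is odd about them),
`kingPrV_imgBond_of_not_mem`, ★ `kingPrV_imgBond_of_mem` (the bond twist by one FINE step is invisible to the floor off the upper faces of the coarse cells: there the paired twisted
image sits one coarse bond higher), ★★ `reflSet_pull_kingPrV`∕`reflSet_comp_pull_kingPrV`: `R′_T ∘ P = P ∘ R_T + M_{mask_T} ∘ P ∘ R_T ∘ D`, ★★ `idef_symOp_kingPrV`: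
`𝔇(Sym′, Sym) = Σ_T M_{mask_T} ∘ P ∘ R_T ∘ D` — `2^{d+1}` masked, paired, reflected own-direction COARSE differences (each worth `η` against the `η⁻¹`-normalised (1.110) gradient letter).
HONEST FRAMING.  Finite lattice geometry (`ℤ∕(L^rL^kM)` → `ℤ∕(L^kM)` floors); no estimate; nothing of [B6]∕[B9]∕[King1986] asserted beyond the pairing convention; N15 NOT discharged
(object-bound; NE2⁺ NOT PRINTED); counts UNMOVED (typed 28∕28 · discharged 5∕27); one finite torus pair — NOT continuum ∕ ℝ⁴ ∕ OS ∕ mass gap ∕ Clay.  Two plumbing defs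
(`faceMask`, `ownDiff`); every theorem [folklore] lattice algebra.
-/

noncomputable section

open scoped BigOperators Matrix
open Finset

namespace Summit.QuantumFields.YangMills.BalabanUVNodes.N15.TwoGrid

open Literature.MathematicalPhysics.QuantumFieldTheory.Balaban1983to89
open Literature.MathematicalPhysics.QuantumFieldTheory.Balaban1983to89.B5Prop11Plancherel (Tor fine unitVec)
open Literature.MathematicalPhysics.QuantumFieldTheory.Balaban1983to89.B5Block118 (up bpt upHom upHom_intCast)
open Literature.MathematicalPhysics.QuantumFieldTheory.Balaban1983to89.B6Prop26Gluing (mulOp mulOp_apply ind ind_nonneg ind_le_one)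
open Literature.MathematicalPhysics.QuantumFieldTheory.King1986.Torus (blockOf tdistT)
open Literature.MathematicalPhysics.QuantumFieldTheory.Balaban1983to89.B11SectG (BlockNorm HasMaj)
open Literature.MathematicalPhysics.QuantumFieldTheory.Balaban1983to89.B6UnitTorusCarrier (unitTorusGeo)
open Literature.MathematicalPhysics.QuantumFieldTheory.Balaban1983to89.B5SiteBridgeP12 (MP)
open Literature.MathematicalPhysics.QuantumFieldTheory.Balaban1983to89.T4EtaRateDefect (idef idef_comp)
open Literature.MathematicalPhysics.QuantumFieldTheory.Balaban1983to89.T4EtaRateCoeffDefect (pull pull_apply)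
open Summit.QuantumFields.YangMills.BalabanUVNodes.N15.VectorPiece (blkFine kingPr kingPrV kingPr_val kingPr_add_unitVec blkFine_comp_kingPrV)

variable {d : ℕ}

/-! ## §12 Two spacings: the face mask and the own-direction difference -/

section Plumbing

variable (M : Fin (d + 1) → ℕ) [∀ μ, NeZero (M μ)] (n : ℕ) [NeZero n]

/-- THE FACE MASK of the multi-reflection `R_T` between two lattice spacings (`R` fine steps per coarse step): `1` exactly on the fine bonds whose own direction `μ` is reflected
(`μ ∈ T`) and whose start point is NOT on the upper `μ`-face of its coarse cell (`R ∤ x′_μ + 1`) — the bonds where King's pairing of the twisted image and the twisted image of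
King's pairing differ by one coarse bond. [folklore] -/
def faceMask (R : ℕ) (T : Finset (Fin (d + 1))) (b : Tor (fine n M) × Fin (d + 1)) : ℝ :=
  if b.2 ∈ T ∧ ¬R ∣ (b.1 b.2).val + 1 then 1 else 0

/-- THE OWN-DIRECTION FORWARD DIFFERENCE of a 1-form, `(DA)(x, μ) = A(x + e_μ, μ) − A(x, μ)` (one lattice step, no `η⁻¹`): `D = Σ_ν 1_{μ = ν}·ρ(s_ν − 1)`. [folklore] -/
def ownDiff : (Tor (fine n M) × Fin (d + 1) → ℝ) →ₗ[ℝ] (Tor (fine n M) × Fin (d + 1) → ℝ) :=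
  ∑ ν : Fin (d + 1), mulOp (fun b : Tor (fine n M) × Fin (d + 1) => if b.2 = ν then (1 : ℝ) else 0) ∘ₗ symbOp M n (sD M n ν 1)

variable {M n}

omit [∀ μ, NeZero (M μ)] [NeZero n] in
/-- `|mask| ≤ 1`. [folklore] -/
theorem abs_faceMask_le_one (R : ℕ) (T : Finset (Fin (d + 1))) (b : Tor (fine n M) × Fin (d + 1)) : |faceMask M n R T b| ≤ 1 := by
  unfold faceMask; split_ifs <;> simp

omit [∀ μ, NeZero (M μ)] [NeZero n] in
/-- the mask vanishes on bonds whose direction is not reflected. [folklore] -/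
theorem faceMask_of_not_mem {R : ℕ} {T : Finset (Fin (d + 1))} {b : Tor (fine n M) × Fin (d + 1)} (h : b.2 ∉ T) : faceMask M n R T b = 0 := by
  unfold faceMask; exact if_neg fun h' => h h'.1

omit [∀ μ, NeZero (M μ)] [NeZero n] in
/-- `(DA)(x, μ) = A(x + e_μ, μ) − A(x, μ)`. [folklore] -/
theorem ownDiff_apply (A : Tor (fine n M) × Fin (d + 1) → ℝ) (b : Tor (fine n M) × Fin (d + 1)) :
    ownDiff M n A b = A (b.1 + unitVec (fine n M) b.2, b.2) - A b := by
  rw [ownDiff, LinearMap.sum_apply, Finset.sum_apply, Finset.sum_eq_single b.2]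
  · rw [LinearMap.comp_apply, mulOp_apply, if_pos rfl, one_mul, symbOp_sD_apply, one_mul]
  · intro ν _ hν
    rw [LinearMap.comp_apply, mulOp_apply, if_neg (Ne.symm hν), zero_mul]
  · intro h; exact absurd (Finset.mem_univ _) h

/-- finite sums of linear maps compose termwise on the right. [folklore] -/
theorem fsum_comp {ι F₁ F₂ F₃ : Type} [AddCommGroup F₁] [Module ℝ F₁] [AddCommGroup F₂] [Module ℝ F₂] [AddCommGroup F₃] [Module ℝ F₃] (s : Finset ι)
    (X : ι → F₂ →ₗ[ℝ] F₃) (Y : F₁ →ₗ[ℝ] F₂) : (∑ i ∈ s, X i) ∘ₗ Y = ∑ i ∈ s, X i ∘ₗ Y :=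
  LinearMap.ext fun f => by simp only [LinearMap.comp_apply, LinearMap.sum_apply]

/-- … and on the left. [folklore] -/
theorem comp_fsum {ι F₁ F₂ F₃ : Type} [AddCommGroup F₁] [Module ℝ F₁] [AddCommGroup F₂] [Module ℝ F₂] [AddCommGroup F₃] [Module ℝ F₃] (s : Finset ι)
    (Y : F₂ →ₗ[ℝ] F₃) (X : ι → F₁ →ₗ[ℝ] F₂) : Y ∘ₗ (∑ i ∈ s, X i) = ∑ i ∈ s, Y ∘ₗ X i :=
  LinearMap.ext fun f => by simp only [LinearMap.comp_apply, LinearMap.sum_apply, map_sum]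

end Plumbing

/-! ## §13 KING's PAIRING AND THE IMAGES: coordinatewise floor maps commute with block-face reflections; on bonds, up to the face mask times one own-direction difference -/

section Pairing

/-- FLOOR OF A REFLECTED RESIDUE: `⌊(RB − 1 − X)∕R⌋ = B − 1 − ⌊X∕R⌋` read in `ℤ∕B` — a coordinatewise floor map `ℤ∕(RB) → ℤ∕B` commutes with `z ↦ −1 − z`. [folklore] -/
theorem natCast_div_neg_one_sub {A B R : ℕ} [NeZero A] [NeZero B] (hAB : A = R * B) (z : ZMod A) :
    ((((-1 - z).val / R : ℕ)) : ZMod B) = -1 - (((z.val / R : ℕ)) : ZMod B) := by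
  obtain ⟨A', hA'⟩ := Nat.exists_eq_succ_of_ne_zero (NeZero.ne A)
  subst hA'
  have hR : 0 < R := Nat.pos_of_ne_zero fun h => by rw [h, zero_mul] at hAB; exact Nat.succ_ne_zero A' hAB
  have hz : z.val < A' + 1 := ZMod.val_lt z
  have hval : (-1 - z).val = A' - z.val := by
    rw [ZMod.val_sub (by rw [ZMod.val_neg_one]; omega), ZMod.val_neg_one]
  rw [hval]
  set q := z.val / R with hq
  set s := z.val % R with hs
  have hqs : s + R * q = z.val := Nat.mod_add_div z.val R
  have hsR : s < R := Nat.mod_lt _ hR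
  have hqB : q < B := Nat.div_lt_of_lt_mul (by rw [← hAB]; exact hz)
  have hdecomp : A' - z.val = R * (B - 1 - q) + (R - 1 - s) := by
    have hB : B = (B - 1 - q) + q + 1 := by omega
    have hW : R * B = R * (B - 1 - q) + R * q + R := (congrArg (R * ·) hB).trans (by ring)
    generalize R * (B - 1 - q) = W at hW ⊢
    generalize R * q = P at hW hqs ⊢
    omega
  rw [hdecomp, Nat.mul_add_div hR, Nat.div_eq_of_lt (by omega : R - 1 - s < R), add_zero,
    show B - 1 - q = B - (1 + q) by omega, Nat.cast_sub (by omega : 1 + q ≤ B), ZMod.natCast_self, Nat.cast_add, Nat.cast_one]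
  ring

/-- FLOOR OF A BLOCK-TRANSLATED RESIDUE: `⌊(X − Rt)∕R⌋ = ⌊X∕R⌋ − t` read in `ℤ∕B`. [folklore] -/
theorem natCast_div_sub_mul {A B R : ℕ} [NeZero A] [NeZero B] (hAB : A = R * B) (z : ZMod A) (t : ℕ) :
    ((((z - ((R * t : ℕ) : ZMod A)).val / R : ℕ)) : ZMod B) = (((z.val / R : ℕ)) : ZMod B) - (t : ZMod B) := by
  have hR : 0 < R := Nat.pos_of_ne_zero fun h => by rw [h, zero_mul] at hAB; exact NeZero.ne A hAB
  -- the additive form on `w := z − Rt`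
  have hadd : ∀ w : ZMod A, ((((w + ((R * t : ℕ) : ZMod A)).val / R : ℕ)) : ZMod B) = (((w.val / R : ℕ)) : ZMod B) + (t : ZMod B) := by
    intro w
    have hv : (w + ((R * t : ℕ) : ZMod A)).val = (w.val + R * t) % A := by rw [ZMod.val_add, ZMod.val_natCast, Nat.add_mod_mod]
    have hdiv : (w.val + R * t) % A / R = (w.val + R * t) / R % B := by
      rw [congrArg (fun m => (w.val + R * t) % m / R) hAB]
      exact Nat.mod_mul_right_div_self _ _ _
    rw [hv, hdiv, Nat.add_mul_div_left _ _ hR, ZMod.natCast_mod, Nat.cast_add]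
  have h := hadd (z - ((R * t : ℕ) : ZMod A))
  rw [sub_add_cancel] at h
  rw [h, add_sub_cancel_right]

variable {M : Fin (d + 1) → ℕ} [∀ μ, NeZero (M μ)] {n : ℕ} [NeZero n]

omit [NeZero n] in
/-- `(n·y)_ν = n·y_ν` as a natural-number cast. [folklore] -/
theorem up_apply_natCast (y : Tor M) (ν : Fin (d + 1)) : up n M y ν = ((n * (y ν).val : ℕ) : ZMod (fine n M ν)) := by
  have hy : y ν = (((y ν).val : ℤ) : ZMod (M ν)) := by rw [Int.cast_natCast, ZMod.natCast_zmod_val]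
  show upHom n M ν (y ν) = _
  conv_lhs => rw [hy]
  rw [upHom_intCast]
  push_cast
  ring

variable (L k r : ℕ) [NeZero L] (c : Tor M)

/-- ★ **KING's PAIRING COMMUTES WITH THE POINT IMAGES**: `pr(img′_T x′) = img_T (pr x′)` — the mirrors `x_ν = n c_ν − ½` of the coarse lattice are the mirrors `x′_ν = n′c_ν − ½` of the fine
one, and `⌊·∕L^r⌋` is odd about them. [cite: King1986, p.664 (pairing convention «x′ ∈ B^n(x)»)] -/
theorem kingPr_imgPt (T : Finset (Fin (d + 1))) (x' : Tor (fine (L ^ r * L ^ k) M)) :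
    kingPr L k r M (imgPt M (L ^ r * L ^ k) c T x') = imgPt M (L ^ k) c T (kingPr L k r M x') := by
  funext ν
  show ((((imgPt M (L ^ r * L ^ k) c T x') ν).val / L ^ r : ℕ) : ZMod (fine (L ^ k) M ν)) = _
  simp only [imgPt]
  by_cases hν : ν ∈ T
  · rw [if_pos hν, if_pos hν]
    have hAB : fine (L ^ r * L ^ k) M ν = L ^ r * fine (L ^ k) M ν := Nat.mul_assoc _ _ _
    have h2 : (2 : ZMod (fine (L ^ r * L ^ k) M ν)) * up (L ^ r * L ^ k) M c ν - 1 - x' ν =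
        -1 - (x' ν - ((L ^ r * (2 * (L ^ k * (c ν).val)) : ℕ) : ZMod (fine (L ^ r * L ^ k) M ν))) := by
      rw [up_apply_natCast]; push_cast; ring
    rw [h2, natCast_div_neg_one_sub hAB, natCast_div_sub_mul hAB, up_apply_natCast,
      show kingPr L k r M x' ν = (((x' ν).val / L ^ r : ℕ) : ZMod (fine (L ^ k) M ν)) from rfl]
    push_cast
    ring
  · rw [if_neg hν, if_neg hν]
    rfl

omit [∀ μ, NeZero (M μ)] [NeZero L] in
/-- the sign of the multi-reflection is read on the direction only, hence through the pairing. [folklore] -/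
theorem sgnT_kingPrV (T : Finset (Fin (d + 1))) (b' : Tor (fine (L ^ r * L ^ k) M) × Fin (d + 1)) :
    sgnT M (L ^ k) T (kingPrV L k r M b') = sgnT M (L ^ r * L ^ k) T b' := rfl

/-- the pairing of the image of a bond whose direction is NOT reflected is the image of its pairing. [cite: King1986, p.664 (pairing convention)] -/
theorem kingPrV_imgBond_of_not_mem {T : Finset (Fin (d + 1))} {b' : Tor (fine (L ^ r * L ^ k) M) × Fin (d + 1)} (hμ : b'.2 ∉ T) :
    kingPrV L k r M (imgBond M (L ^ r * L ^ k) c T b') = imgBond M (L ^ k) c T (kingPrV L k r M b') := by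
  simp only [kingPrV, imgBond, if_neg hμ, sub_zero, kingPr_imgPt]

/-- ★ the pairing of the TWISTED image of a bond whose direction IS reflected: the twisted image of its pairing when the start point lies on the upper face of its coarse cell
(`L^r ∣ x′_μ + 1`), one coarse bond HIGHER otherwise (the twist by one fine step is invisible to the floor). [cite: King1986, p.664 (pairing convention)] -/
theorem kingPrV_imgBond_of_mem {T : Finset (Fin (d + 1))} {b' : Tor (fine (L ^ r * L ^ k) M) × Fin (d + 1)} (hμ : b'.2 ∈ T) :
    kingPrV L k r M (imgBond M (L ^ r * L ^ k) c T b') =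
      if L ^ r ∣ (b'.1 b'.2).val + 1 then imgBond M (L ^ k) c T (kingPrV L k r M b') else (imgPt M (L ^ k) c T (kingPr L k r M b'.1), b'.2) := by
  have himg : imgBond M (L ^ r * L ^ k) c T b' = (imgPt M (L ^ r * L ^ k) c T (b'.1 + unitVec (fine (L ^ r * L ^ k) M) b'.2), b'.2) := by
    simp only [imgBond, if_pos hμ, imgPt_add_unitVec_of_mem hμ]
  rw [himg, kingPrV, kingPr_imgPt, kingPr_add_unitVec M L k r b'.1 b'.2]
  by_cases hdvd : L ^ r ∣ (b'.1 b'.2).val + 1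
  · rw [if_pos hdvd, if_pos hdvd, imgPt_add_unitVec_of_mem hμ]
    simp only [imgBond, kingPrV, if_pos hμ]
  · rw [if_neg hdvd, if_neg hdvd]

/-- ★★ **THE MULTI-REFLECTION THROUGH KING's PROLONGATION**: `R′_T ∘ P = P ∘ R_T + M_{mask_T} ∘ P ∘ R_T ∘ D` (`P = pull prV`, `D` the own-direction coarse difference) — EXACT on the
bonds off the mask, off by ONE COARSE DIFFERENCE of the argument on it. [cite: King1986, p.664 (pairing convention); Balaban1984PropagatorsII, (2.37) p.229 (images)] -/
theorem reflSet_pull_kingPrV (T : Finset (Fin (d + 1))) (A : Tor (fine (L ^ k) M) × Fin (d + 1) → ℝ) :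
    reflSet M (L ^ r * L ^ k) c T (pull (kingPrV L k r M) A) =
      pull (kingPrV L k r M) (reflSet M (L ^ k) c T A) +
        mulOp (faceMask M (L ^ r * L ^ k) (L ^ r) T) (pull (kingPrV L k r M) (reflSet M (L ^ k) c T (ownDiff M (L ^ k) A))) := by
  funext b'
  simp only [reflSet_apply, pull_apply, Pi.add_apply, mulOp_apply, ownDiff_apply, sgnT_kingPrV]
  by_cases hμ : b'.2 ∈ T
  · rw [kingPrV_imgBond_of_mem L k r c hμ]
    by_cases hdvd : L ^ r ∣ (b'.1 b'.2).val + 1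
    · rw [if_pos hdvd, show faceMask M (L ^ r * L ^ k) (L ^ r) T b' = 0 from if_neg fun h => h.2 hdvd]
      ring
    · rw [if_neg hdvd, show faceMask M (L ^ r * L ^ k) (L ^ r) T b' = 1 from if_pos ⟨hμ, hdvd⟩]
      have h1 : (imgBond M (L ^ k) c T (kingPrV L k r M b')).1 + unitVec (fine (L ^ k) M) (imgBond M (L ^ k) c T (kingPrV L k r M b')).2 =
          imgPt M (L ^ k) c T (kingPr L k r M b'.1) := by
        simp only [imgBond, kingPrV, if_pos hμ, sub_add_cancel]
      have h2 : (imgBond M (L ^ k) c T (kingPrV L k r M b')).2 = b'.2 := rfl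
      rw [h1, h2]
      ring
  · rw [kingPrV_imgBond_of_not_mem L k r c hμ, faceMask_of_not_mem hμ]
    ring

/-- the same as linear maps. [folklore] -/
theorem reflSet_comp_pull_kingPrV (T : Finset (Fin (d + 1))) :
    reflSet M (L ^ r * L ^ k) c T ∘ₗ pull (kingPrV L k r M) =
      pull (kingPrV L k r M) ∘ₗ reflSet M (L ^ k) c T +
        mulOp (faceMask M (L ^ r * L ^ k) (L ^ r) T) ∘ₗ pull (kingPrV L k r M) ∘ₗ reflSet M (L ^ k) c T ∘ₗ ownDiff M (L ^ k) :=
  LinearMap.ext fun A => reflSet_pull_kingPrV L k r c T A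

/-- ★★ **THE η-DEFECT OF THE SYMMETRISER**: `𝔇(Sym′, Sym) = Sym′∘P − P∘Sym = Σ_T M_{mask_T} ∘ P ∘ R_T ∘ D` — a sum of `2^{d+1}` masked, paired, reflected OWN-DIRECTION COARSE DIFFERENCES
(each worth `η` against an `η⁻¹`-normalised gradient letter). [cite: Balaban1985BackgroundPropagators, (3.42) p.397 (η-defects, shape); King1986, p.664 (pairing)] -/
theorem idef_symOp_kingPrV :
    idef (pull (kingPrV L k r M)) (pull (kingPrV L k r M)) (symOp M (L ^ r * L ^ k) c) (symOp M (L ^ k) c) =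
      ∑ T ∈ (Finset.univ : Finset (Fin (d + 1))).powerset,
        mulOp (faceMask M (L ^ r * L ^ k) (L ^ r) T) ∘ₗ pull (kingPrV L k r M) ∘ₗ reflSet M (L ^ k) c T ∘ₗ ownDiff M (L ^ k) := by
  rw [idef, symOp, symOp, fsum_comp, comp_fsum, ← Finset.sum_sub_distrib]
  refine Finset.sum_congr rfl fun T _ => ?_
  rw [reflSet_comp_pull_kingPrV, add_sub_cancel_left]

end Pairing


end Summit.QuantumFields.YangMills.BalabanUVNodes.N15.TwoGrid
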